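import Mathlib
import Literature.MathematicalPhysics.QuantumFieldTheory.Balaban1983to89.B16Eq117Expansion
import Literature.MathematicalPhysics.QuantumFieldTheory.Balaban1983to89.B16Sect1Statements
import Literature.MathematicalPhysics.QuantumFieldTheory.Balaban1983to89.B9SectDWalk
import Literature.MathematicalPhysics.QuantumFieldTheory.Balaban1983to89.B11SupSize190

/-!
# `Balaban1983to89.B16Ineq127FromWalks` — [Balaban1989LargeFieldII] (1.27) p. 362 «|DH_{X₀,(Ω″~_{h+1})^c}B| <
O(1)(L^jη)^{−2}exp(−¼δ₀MR_{h+1})A₁p₁(g_k)» DERIVED from the printed random-walk mechanism of p. 362 over the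
(3.107)/(3.108) [13] shapes

T. Bałaban, *Large field renormalization. II. Localization, exponentiation, and bounds for the 𝐑 operation*, Commun. Math.
Phys. **122** (1989) 355–392 [Balaban1989LargeFieldII] (cell paper B16; PDF held `paper:balaban1989-cmp122-large-field-ii`,
journal page = PDF page + 354; p. 362 = PDF 8, text layer `p0008.txt` read by this seat), with T. Bałaban, *Propagators for lattice
gauge theories in a background field*, Commun. Math. Phys. **99** (1985) 389–434 [Balaban1985BackgroundPropagators] (= [13] of the
paper; (3.93) p. 410, (3.107)–(3.108) p. 416) and T. Bałaban, *Propagators and renormalization transformations … II*, Commun. Math.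
Phys. **96** (1984) [Balaban1984PropagatorsII], Lemma 2.1 (2.61) p. 234.

statement-level skeleton of published theorems with citation tags; proofs where landed; nothing here is a claim about the Yang–Mills mass gap

CITATION HEADER / WHAT IS REPRODUCED.  Mega-formalization `lit-balaban`, HOME `run/shared/lean/pub/lit-balaban/`; Phase-2 proof seat
p29 gen 9 (unit `lit-balaban-p29`, free-target protocol G.5-34(d)).  SKELETON row **B16.Eq1.27** (owner r13; typed leaf
`B16Sect1Statements.Ineq127 nDHB C Ljη δ₀ M Rh1 A₁ p₁g := nDHB < C·(Ljη²)⁻¹·exp(−¼δ₀MR_{h+1})·A₁·p₁g`, r13 gen 2; the splitting (1.26)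
and its random-walk ORIGIN typed by r13 gen 4 as `B16Eq117Expansion.Hbd126`/`RW126`, with `Hbd126_eq_sum_erase` PROVED: under `RW126`
the boundary part IS the sum of the walk terms other than `(0, X₀)`; r13's `SURVEY-B16-remaining.md` §B lists (1.27) as an analytic
leaf «(3.108) [13] generalized random-walk expansion»).
THE PRINT (p. 362 [PDF 8]): *«At first we localize the minimizer H″_{1,k,Z}. We construct the generalized random walk expansion for
it, including Z ∩ Ω″~_{h+1} as one of the localization domains X, see Sect. C [13] for details. Other localization domains are the
same as in that paper; they are based on the partitions into M₁-cubes in corresponding scales, and they intersect the domain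
(Ω″~_{h+1})^c. The expansion has the form (3.107) [13], where X₀ = Z ∩ Ω″~_{h+1}, and the terms of the expansion satisfy (3.108) [13].
… More precisely the first argument of their kernels is restricted to the support of ζ, hence the first term of the expansion
corresponds to the walk (0, X₀), and is given by the function H″_{1,k,X₀}. The remaining terms correspond to walks intersecting
(Ω″~_{h+1})^c, hence the bound (3.108) [13] provides the additional exponential factor exp(−¼δ₀MR_{h+1}). We represent H″_{1,k,Z} as
a sum of the first term and the sum of the remaining terms: H″_{1,k,Z} = H″_{1,k,X₀} + H″_{X₀,(Ω″~_{h+1})^c}. (1.26) … The bound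
|DH_{X₀,(Ω″~_{h+1})^c}B| < O(1)(L^jη)^{−2}exp(−¼δ₀MR_{h+1})A₁p₁(g_k) (1.27) allows us to estimate the second term of this
decomposition in the same way as the second term of the expansion (1.24) above, hence it is a small term.»*  [13] (3.108) p. 416:
*«|(R₀(X₀)R_{α₁}(X₁)·…·R_{αₙ}(Xₙ)J)(x)| ≤ O(1)(L^jη)²O(M^{−1/2})^{|ω|}·M^{−½|ω|}e^{−½δ₀d(ω,y,y′)}|J|, x ∈ Δ(y), y ∈ Λ_j, supp J ⊂
Δ(y′)»*, (3.93) p. 410 (the walk distance `d(ω,y,y′)`), and p. 416: *«We will use the factor O(M^{−1/2}) to control the sum over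
random walks ω»*.

THE ROUTE (the printed mechanism, as bookkeeping over pv21's walk vocabulary `B9SectDWalk` and r08's block-majorant vocabulary
`B11SectG`).  Each remaining walk term `T ω`, `ω ≠ (0, X₀)`, has a (3.108)-shape majorant `a_ω·e^{−½δ₀D_ω(y,y′)}` from the B-size to
the size measuring `DH` (`HasMaj`), with a walk distance `D_ω ≥ d` (`DomBy`) which PASSES THROUGH the blocks of (Ω″~_{h+1})^c
(`Through` — *«walks intersecting (Ω″~_{h+1})^c»*, the content of (3.93)); the evaluation block `y` (a block of supp ζ) is at distance
`≥ R ≥ MR_{h+1}` from those blocks.  Then `½δ₀D_ω ≥ ¼δ₀R + ¼δ₀d(y,y′)` (`exp_walk_split`), so `loc_y(Σ_{ω≠ω₀} T_ωB) ≤ Σ_ω Σ_{y′}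
a_ω e^{−¼δ₀R} e^{−¼δ₀d(y,y′)} κ_B loc_{y′}B ≤ Θκ_Bc · m · e^{−¼δ₀R}` (`loc_sum_walks_le`: `HasMaj.bound`, the walk-counting letter
`Σ_{ω≠ω₀} a_ω ≤ Θ` — (3.108)'s `(O(1)M^{−1/2})^{|ω|}M^{−½|ω|}` summed, p. 416 —, and the row sum (2.61) at the rate `¼δ₀`), and the
strict B-size `m < A₁p₁(g_k)` with the weight `Θκ_Bc ≤ C(L^jη)^{−2}` gives (1.27) AS TYPED (`ineq127_of_rw126`).

WHAT THIS FILE PROVES (kernel-checked, zero `sorry`, theorems only — no definition, no named fact; axioms standard; BY NAME: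
`B16Eq117Expansion.RW126`/`Hbd126`/`Hbd126_eq_sum_erase` and `B16Sect1Statements.Ineq127` (r13), `B9SectDWalk.DomBy`/`Through` (pv21),
`B11SectG.HasMaj`/`HasMaj.bound`/`RowSum` (r08), `B11SupSize190.supSize`/`norm_apply_le_loc` (r11)).
§1 `exp_walk_split` (the rate split `e^{−½δ₀D_ω(y,y′)} ≤ e^{−¼δ₀R}·e^{−¼δ₀d(y,y′)}` for a walk distance through the far blocks),
   **`loc_sum_walks_le`** (the located form of *«the bound (3.108) provides the additional exponential factor exp(−¼δ₀MR_{h+1})»*: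
   `loc_y((Σ_{ω∈S} T_ω)B) ≤ Θκ_Bc·m·e^{−¼δ₀R}`).
§2 **`ineq127_of_rw126`** — (1.27) AS TYPED for any `nDHB ≤ bout.loc y (Hbd126 H″_{1,k,Z} H″_{1,k,X₀} B)` under `RW126`;
   **`ineq127_lattice_of_rw126`** — the same with the OUTPUT size concrete (`supSize g box blk` on lattice functions, the dictionary
   letter replaced by membership `x ∈ box y`): `Ineq127 ‖(Hbd126 … B) x‖ C Ljη δ₀ M Rh1 A₁ p₁g`.
HONEST SCOPE.  Located hypotheses, NOT discharged: the walk expansion of `H″_{1,k,Z}` itself with (3.108)-shape per-term bounds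
(Theorem 3.12 [13] *«the inequality (1.133) together with Theorem 3.10 hold for the operators H, H₁»* — the tree's `B9SectDWalk`
reproduces the Sect.-D propagators `G, G₁` and records `H, H₁` as NOT done; r13's `RW126` is a FINITE family standing for the
convergent series — DIVERGENCE «schematic typing», recorded there), the walk-counting letter `Σ a_ω ≤ Θ`, the passage of the remaining
walks through (Ω″~_{h+1})^c, the distance `R ≥ MR_{h+1}` of supp ζ from it, the B-size `< A₁p₁(g_k)` of the chart field, the weight
`Θκ_Bc ≤ C(L^jη)^{−2}` (the `(L^jη)^{−2}` scaling of the `DH`-entry as a letter).  Nothing about `H″_{1,k,Z}`'s construction is used.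
NOT summit progress.
-/

namespace Literature.MathematicalPhysics.QuantumFieldTheory.Balaban1983to89.B16Ineq127FromWalks

open Literature.MathematicalPhysics.QuantumFieldTheory.Balaban1983to89
open B11SectG B9SectDWalk B16Eq117Expansion B16Sect1Statements Finset
open scoped NNReal

noncomputable section

variable {g : B6.Geometry} {FB FA : Type} [AddCommGroup FB] [Module ℝ FB] [AddCommGroup FA] [Module ℝ FA]

/-! ## §1. «walks intersecting (Ω″~_{h+1})^c ⇒ the additional factor exp(−¼δ₀MR_{h+1})» (p. 362; (3.93), (3.108) [13]) -/

/-- **The rate split.**  If the walk distance `D` dominates `d` and passes through a set of blocks `Xc` all at distance `≥ R` from `y`,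
then `e^{−½δ₀D(y,y′)} ≤ e^{−¼δ₀R}·e^{−¼δ₀d(y,y′)}` (`δ₀ ≥ 0`, `d ≥ 0`). [cite: Balaban1989LargeFieldII, p.362 (before (1.26));
Balaban1985BackgroundPropagators, (3.93) p.410] -/
theorem exp_walk_split {D : g.Site → g.Site → ℝ} {Xc : Set g.Site} {δ₀ R : ℝ} (hdom : DomBy g D) (hthr : Through g D Xc)
    (hd : ∀ a b : g.Site, 0 ≤ g.dist a b) (hδ₀ : 0 ≤ δ₀) {y : g.Site} (hfar : ∀ z ∈ Xc, R ≤ g.dist y z) (y' : g.Site) :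
    Real.exp (-(δ₀ / 2 * D y y')) ≤ Real.exp (-(δ₀ / 4 * R)) * Real.exp (-(δ₀ / 4 * g.dist y y')) := by
  obtain ⟨z, hz, hle⟩ := hthr y y'
  have hR : R ≤ D y y' := by linarith [hfar z hz, hd z y']
  have hdd : g.dist y y' ≤ D y y' := hdom y y'
  rw [← Real.exp_add]
  exact Real.exp_le_exp.mpr (by nlinarith)

/-- **The located form of «the bound (3.108) [13] provides the additional exponential factor exp(−¼δ₀MR_{h+1})»** (p. 362): for a
finite family of walk terms `T ω`, `ω ∈ S`, with (3.108)-shape majorants `a_ω e^{−½δ₀D_ω}` (`a_ω ≥ 0`, `Σ_{ω∈S} a_ω ≤ Θ` — the walk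
counting of p. 416 [13]), walk distances `D_ω ≥ d` passing through the blocks `Xc`, the row sum (2.61) at the rate `¼δ₀`, a block `y`
at distance `≥ R` from `Xc`, and an input `B` of B-size `≤ m` (`m ≥ 0`) at every block:
`loc_y((Σ_{ω∈S} T_ω)B) ≤ Θ·κ_B·c·m·e^{−¼δ₀R}`. [cite: Balaban1989LargeFieldII, p.362 (before (1.26)); Balaban1985BackgroundPropagators,
(3.108) p.416; Balaban1984PropagatorsII, (2.61) p.234] -/
theorem loc_sum_walks_le {Ω : Type} {S : Finset Ω} {T : Ω → (FB →ₗ[ℝ] FA)} {bB : BlockNorm g FB} {bout : BlockNorm g FA}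
    {a : Ω → ℝ} {Dw : Ω → g.Site → g.Site → ℝ} {δ₀ Θ c R m : ℝ}
    (hT : ∀ ω ∈ S, HasMaj bB bout (T ω) (fun y y' => a ω * Real.exp (-(δ₀ / 2 * Dw ω y y'))))
    (ha : ∀ ω ∈ S, 0 ≤ a ω) (hΘ : ∑ ω ∈ S, a ω ≤ Θ)
    (hdomBy : ∀ ω ∈ S, DomBy g (Dw ω)) {Xc : Set g.Site} (hthr : ∀ ω ∈ S, Through g (Dw ω) Xc)
    (hd : ∀ a b : g.Site, 0 ≤ g.dist a b) (hδ₀ : 0 ≤ δ₀) (hrow : RowSum g (δ₀ / 4) c)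
    (y : g.Site) (hfar : ∀ z ∈ Xc, R ≤ g.dist y z) (B : FB) (hm : ∀ y', bB.loc y' B ≤ m) (hm0 : 0 ≤ m) :
    bout.loc y ((∑ ω ∈ S, T ω) B) ≤ Θ * bB.κ * c * m * Real.exp (-(δ₀ / 4 * R)) := by
  classical
  have hc : 0 ≤ c := hrow.nonneg y
  have hκ := bB.κ_nonneg
  set ER : ℝ := Real.exp (-(δ₀ / 4 * R)) with hER
  have hER0 : 0 ≤ ER := (Real.exp_pos _).le
  -- term by term through the partition of unity of the B-space
  have h1 : bout.loc y ((∑ ω ∈ S, T ω) B) ≤ ∑ ω ∈ S, bout.loc y (T ω B) := by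
    rw [LinearMap.sum_apply]
    exact bout.loc_sum_le y S fun ω => T ω B
  have h2 : ∀ ω ∈ S, bout.loc y (T ω B) ≤
      ∑ y' : g.Site, a ω * Real.exp (-(δ₀ / 2 * Dw ω y y')) * (bB.κ * bB.loc y' B) := fun ω hω =>
    (hT ω hω).bound (fun _ _ => mul_nonneg (ha ω hω) (Real.exp_pos _).le) B y
  -- the rate split and the B-size
  have h3 : ∀ ω ∈ S, ∀ y' : g.Site, a ω * Real.exp (-(δ₀ / 2 * Dw ω y y')) * (bB.κ * bB.loc y' B) ≤
      a ω * (ER * Real.exp (-(δ₀ / 4 * g.dist y y'))) * (bB.κ * m) := fun ω hω y' =>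
    mul_le_mul (mul_le_mul_of_nonneg_left (exp_walk_split (hdomBy ω hω) (hthr ω hω) hd hδ₀ hfar y') (ha ω hω))
      (mul_le_mul_of_nonneg_left (hm y') hκ) (mul_nonneg hκ (bB.loc_nonneg _ _))
      (mul_nonneg (ha ω hω) (mul_nonneg hER0 (Real.exp_pos _).le))
  -- the row sum (2.61) at rate ¼δ₀
  have h4 : ∀ ω ∈ S, ∑ y' : g.Site, a ω * (ER * Real.exp (-(δ₀ / 4 * g.dist y y'))) * (bB.κ * m) ≤
      a ω * ER * (bB.κ * m) * c := by
    intro ω hω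
    have hre : ∑ y' : g.Site, a ω * (ER * Real.exp (-(δ₀ / 4 * g.dist y y'))) * (bB.κ * m) =
        a ω * ER * (bB.κ * m) * ∑ y' : g.Site, Real.exp (-(δ₀ / 4 * g.dist y y')) := by
      rw [Finset.mul_sum]
      exact Finset.sum_congr rfl fun y' _ => by ring
    rw [hre]
    exact mul_le_mul_of_nonneg_left (hrow y) (mul_nonneg (mul_nonneg (ha ω hω) hER0) (mul_nonneg hκ hm0))
  -- the walk counting
  have h5 : ∑ ω ∈ S, a ω * ER * (bB.κ * m) * c = (∑ ω ∈ S, a ω) * (ER * (bB.κ * m) * c) := by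
    rw [Finset.sum_mul]
    exact Finset.sum_congr rfl fun ω _ => by ring
  calc bout.loc y ((∑ ω ∈ S, T ω) B) ≤ ∑ ω ∈ S, bout.loc y (T ω B) := h1
    _ ≤ ∑ ω ∈ S, ∑ y' : g.Site, a ω * Real.exp (-(δ₀ / 2 * Dw ω y y')) * (bB.κ * bB.loc y' B) :=
        Finset.sum_le_sum h2
    _ ≤ ∑ ω ∈ S, ∑ y' : g.Site, a ω * (ER * Real.exp (-(δ₀ / 4 * g.dist y y'))) * (bB.κ * m) :=
        Finset.sum_le_sum fun ω hω => Finset.sum_le_sum fun y' _ => h3 ω hω y'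
    _ ≤ ∑ ω ∈ S, a ω * ER * (bB.κ * m) * c := Finset.sum_le_sum h4
    _ = (∑ ω ∈ S, a ω) * (ER * (bB.κ * m) * c) := h5
    _ ≤ Θ * (ER * (bB.κ * m) * c) := mul_le_mul_of_nonneg_right hΘ (mul_nonneg (mul_nonneg hER0 (mul_nonneg hκ hm0)) hc)
    _ = Θ * bB.κ * c * m * Real.exp (-(δ₀ / 4 * R)) := by rw [hER]; ring

/-! ## §2. (1.27) AS TYPED under the random-walk origin `RW126` of (1.26) -/

/-- **(1.27) p. 362 FROM THE WALK EXPANSION** — r13's typed leaf `B16Sect1Statements.Ineq127 nDHB C Ljη δ₀ M Rh1 A₁ p₁g` (strict)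
for any `nDHB ≤ bout.loc y (H″_{X₀,(Ω″~_{h+1})^c} B)`, the boundary part being r13's `B16Eq117Expansion.Hbd126 H″_{1,k,Z} H″_{1,k,X₀}`
under the random-walk origin `RW126 walks T (0,X₀) H″_{1,k,Z} H″_{1,k,X₀}` of (1.26) (so that it IS the sum of the remaining walk
terms, `Hbd126_eq_sum_erase`): the remaining terms have (3.108)-shape majorants `a_ω e^{−½δ₀D_ω}` into the size `bout` measuring
`DH` with walk distances `D_ω ≥ d` passing through the blocks `Xc` of (Ω″~_{h+1})^c (*«the remaining terms correspond to walks
intersecting (Ω″~_{h+1})^c»*), `Σ_{ω≠(0,X₀)} a_ω ≤ Θ` (p. 416 [13]), the row sum (2.61) at `¼δ₀`, the block `y` (in supp ζ) at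
distance `≥ R ≥ MR_{h+1}` from `Xc`, the chart field `B` of B-size `< A₁p₁(g_k)` at every block, and the weight `Θκ_Bc ≤ C(L^jη)^{−2}`
(`C > 0`, `L^jη > 0`). [cite: Balaban1989LargeFieldII, (1.26)–(1.27) p.362; Balaban1985BackgroundPropagators, (3.107)–(3.108) p.416] -/
theorem ineq127_of_rw126 {Ω : Type} [DecidableEq Ω] {walks : Finset Ω} {T : Ω → (FB →ₗ[ℝ] FA)} {ω₀ : Ω}
    {H1kZ H1kX0 : FB →ₗ[ℝ] FA} (hRW : RW126 walks T ω₀ H1kZ H1kX0)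
    {bB : BlockNorm g FB} {bout : BlockNorm g FA} {a : Ω → ℝ} {Dw : Ω → g.Site → g.Site → ℝ}
    {δ₀ Θ c R C Ljη M Rh1 A₁ p₁g nDHB : ℝ}
    (hT : ∀ ω ∈ walks.erase ω₀, HasMaj bB bout (T ω) (fun y y' => a ω * Real.exp (-(δ₀ / 2 * Dw ω y y'))))
    (ha : ∀ ω ∈ walks.erase ω₀, 0 ≤ a ω) (hΘ : ∑ ω ∈ walks.erase ω₀, a ω ≤ Θ)
    (hdomBy : ∀ ω ∈ walks.erase ω₀, DomBy g (Dw ω)) {Xc : Set g.Site}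
    (hthr : ∀ ω ∈ walks.erase ω₀, Through g (Dw ω) Xc)
    (hd : ∀ a b : g.Site, 0 ≤ g.dist a b) (hδ₀ : 0 ≤ δ₀) (hrow : RowSum g (δ₀ / 4) c)
    (y : g.Site) (hfar : ∀ z ∈ Xc, R ≤ g.dist y z) (hR : M * Rh1 ≤ R)
    (B : FB) (hm : ∀ y', bB.loc y' B < A₁ * p₁g)
    (hw : Θ * bB.κ * c ≤ C * (Ljη ^ 2)⁻¹) (hC : 0 < C) (hL : 0 < Ljη)
    (hdom : nDHB ≤ bout.loc y (Hbd126 H1kZ H1kX0 B)) :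
    Ineq127 nDHB C Ljη δ₀ M Rh1 A₁ p₁g := by
  classical
  -- the uniform B-size `m := max_{y′} loc y′ B < A₁p₁(g_k)`
  set m : ℝ := Finset.univ.sup' ⟨y, Finset.mem_univ y⟩ (fun y' => bB.loc y' B) with hm_def
  have hm_le : ∀ y', bB.loc y' B ≤ m := fun y' => Finset.le_sup' (fun y' => bB.loc y' B) (Finset.mem_univ y')
  have hm_lt : m < A₁ * p₁g := (Finset.sup'_lt_iff _).mpr fun y' _ => hm y'
  have hm0 : 0 ≤ m := (bB.loc_nonneg y B).trans (hm_le y)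
  have hΘ0 : 0 ≤ Θ := (Finset.sum_nonneg fun ω hω => ha ω hω).trans hΘ
  have hc : 0 ≤ c := hrow.nonneg y
  have hκ := bB.κ_nonneg
  -- the boundary part is the sum of the remaining walk terms
  rw [Hbd126_eq_sum_erase hRW] at hdom
  have h1 := loc_sum_walks_le hT ha hΘ hdomBy hthr hd hδ₀ hrow y hfar B hm_le hm0
  have hexp : Real.exp (-(δ₀ / 4 * R)) ≤ Real.exp (-(1 / 4 * δ₀ * M * Rh1)) :=
    Real.exp_le_exp.mpr (by nlinarith)
  have hE : 0 < Real.exp (-(1 / 4 * δ₀ * M * Rh1)) := Real.exp_pos _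
  have hL2 : 0 < (Ljη ^ 2)⁻¹ := by positivity
  have h2 : Θ * bB.κ * c * m * Real.exp (-(δ₀ / 4 * R)) ≤ C * (Ljη ^ 2)⁻¹ * m * Real.exp (-(1 / 4 * δ₀ * M * Rh1)) :=
    mul_le_mul (mul_le_mul_of_nonneg_right hw hm0) hexp (Real.exp_pos _).le (by positivity)
  have h3 : C * (Ljη ^ 2)⁻¹ * m * Real.exp (-(1 / 4 * δ₀ * M * Rh1)) <
      C * (Ljη ^ 2)⁻¹ * (A₁ * p₁g) * Real.exp (-(1 / 4 * δ₀ * M * Rh1)) :=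
    mul_lt_mul_of_pos_right (mul_lt_mul_of_pos_left hm_lt (mul_pos hC hL2)) hE
  unfold Ineq127
  calc nDHB ≤ bout.loc y ((∑ ω ∈ walks.erase ω₀, T ω) B) := hdom
    _ ≤ Θ * bB.κ * c * m * Real.exp (-(δ₀ / 4 * R)) := h1
    _ ≤ C * (Ljη ^ 2)⁻¹ * m * Real.exp (-(1 / 4 * δ₀ * M * Rh1)) := h2
    _ < C * (Ljη ^ 2)⁻¹ * (A₁ * p₁g) * Real.exp (-(1 / 4 * δ₀ * M * Rh1)) := h3
    _ = C * (Ljη ^ 2)⁻¹ * Real.exp (-(1 / 4 * δ₀ * M * Rh1)) * A₁ * p₁g := by ring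

section Lattice

open B11SupSize190

variable {X E : Type} [NormedAddCommGroup E] [NormedSpace ℝ E] {box : g.Site → Finset X} {blk : X → g.Site}

/-- **(1.27) p. 362 with the OUTPUT SIZE CONCRETE** — the same for the lattice field `(H″_{X₀,(Ω″~_{h+1})^c}B)(x) = (Hbd126 … B) x`
measured by r11's sup-over-the-block size `supSize g box blk` (scale weights inside the values as usual); the dictionary letter is
replaced by membership `x ∈ box y`: `Ineq127 ‖(Hbd126 H″_{1,k,Z} H″_{1,k,X₀} B) x‖ C Ljη δ₀ M Rh1 A₁ p₁g`.
[cite: Balaban1989LargeFieldII, (1.26)–(1.27) p.362; Balaban1985BackgroundPropagators, (3.107)–(3.108) p.416] -/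
theorem ineq127_lattice_of_rw126 {Ω : Type} [DecidableEq Ω] {walks : Finset Ω} {T : Ω → (FB →ₗ[ℝ] (X → E))} {ω₀ : Ω}
    {H1kZ H1kX0 : FB →ₗ[ℝ] (X → E)} (hRW : RW126 walks T ω₀ H1kZ H1kX0)
    {bB : BlockNorm g FB} {a : Ω → ℝ} {Dw : Ω → g.Site → g.Site → ℝ} {δ₀ Θ c R C Ljη M Rh1 A₁ p₁g : ℝ}
    (hT : ∀ ω ∈ walks.erase ω₀,
      HasMaj bB (supSize g box blk : BlockNorm g (X → E)) (T ω) (fun y y' => a ω * Real.exp (-(δ₀ / 2 * Dw ω y y'))))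
    (ha : ∀ ω ∈ walks.erase ω₀, 0 ≤ a ω) (hΘ : ∑ ω ∈ walks.erase ω₀, a ω ≤ Θ)
    (hdomBy : ∀ ω ∈ walks.erase ω₀, DomBy g (Dw ω)) {Xc : Set g.Site}
    (hthr : ∀ ω ∈ walks.erase ω₀, Through g (Dw ω) Xc)
    (hd : ∀ a b : g.Site, 0 ≤ g.dist a b) (hδ₀ : 0 ≤ δ₀) (hrow : RowSum g (δ₀ / 4) c)
    (y : g.Site) (hfar : ∀ z ∈ Xc, R ≤ g.dist y z) (hR : M * Rh1 ≤ R)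
    (B : FB) (hm : ∀ y', bB.loc y' B < A₁ * p₁g)
    (hw : Θ * bB.κ * c ≤ C * (Ljη ^ 2)⁻¹) (hC : 0 < C) (hL : 0 < Ljη) {x : X} (hx : x ∈ box y) :
    Ineq127 ‖(Hbd126 H1kZ H1kX0 B) x‖ C Ljη δ₀ M Rh1 A₁ p₁g :=
  ineq127_of_rw126 hRW hT ha hΘ hdomBy hthr hd hδ₀ hrow y hfar hR B hm hw hC hL (norm_apply_le_loc hx _)

end Lattice

end

end Literature.MathematicalPhysics.QuantumFieldTheory.Balaban1983to89.B16Ineq127FromWalks
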